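import Literature.Combinatorics.SetFamily.SpreadLemmaProofs
import HarnessLib

/-!
# The Park–Pham theorem in `p`-small form (Kahn–Kalai conjecture), `p`-biased version

**The Park–Pham theorem** (J. Park, H. T. Pham, *A proof of the Kahn–Kalai conjecture*, J. Amer.
Math. Soc. 37 (2024), Thm. 1.1 / Thm. 1.4; T. Bell, *The Park–Pham theorem with optimal
convergence rate*, Electron. J. Combin. 30(2) (2023), Thm. 3): for an `ℓ`-bounded family `F` in
a finite ground set and `p, ε ∈ (0, 1/2]`, if `F` is NOT `q`-small for `q = p / (B log(ℓ/ε))` —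
every family `G` undercovering `F` (each member of `F` contains a member of `G`) has
`∑_{T ∈ G} q^{|T|} ≥ 1` — then a `p`-random subset contains a member of `F` with probability
`> 1 - ε`. Equivalently `p_c(⟨F⟩) ≤ B q(F) log ℓ` (the expectation-threshold conjecture of Kahn
and Kalai), here with budget `1` instead of `1/2` in the definition of smallness (immaterial up to
the constant) and the explicit constant `B = spreadConst = 2000`.

PROVED by re-running the tree's proof of the spread lemma (`SpreadLemmaProofs.lean`, Bell's
halving process `SpreadLemmaProcess.lean`): that proof uses `r`-spreadness of `F` at exactly one
place, the endgame `Inv.exists_subset_of_l_eq_zero`, and only through Bell's Lemma 10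
(`one_le_sum_inv_pow_of_cover`: a spread family is not `r⁻¹`-small). Replacing spreadness by
its consequence "not `r⁻¹`-small" gives the theorem as Park and Pham state it:

* `Inv.exists_subset_of_l_eq_zero_of_notSmall` — endgame under the not-small hypothesis;
* `sum_biasedWeight_noWitness_le_failVal_of_notSmall` — the process-to-random-set link;
* `parkPham_spreadConst` — the theorem with `B = spreadConst`; `parkPham` — the `∃ B > 0` form;
* (the spread lemma `spread_lemma_spreadConst` is the special case of a spread family, by
  `one_le_sum_inv_pow_of_cover` = Bell 2023, Lemma 10).

## References

* J. Park, H. T. Pham, *A proof of the Kahn–Kalai conjecture*, J. Amer. Math. Soc. 37 (2024),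
  Thm. 1.1, Lemma 2.1 [ParkPham2024].
* T. Bell, *The Park–Pham theorem with optimal convergence rate*, Electron. J. Combin. 30(2)
  (2023) P2.25, Thm. 3, Lemma 10 [Bell2023].
-/

namespace Literature.Combinatorics.SetFamily

open Finset

variable {α : Type*} [Fintype α] [DecidableEq α]

omit [Fintype α] in
/-- **Endgame under the not-small hypothesis** (Park–Pham 2024, proof of Thm. 1.4; Bell 2023,
end of the proof of Thm. 3): if the level has dropped to `0` and every undercover of `F` costs
`≥ 1` at rate `r⁻¹`, then some member of `F` lies inside the used elements `V` — otherwise the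
collected cover `U` undercovers `F` at cost `≤ Θ(l₀) < 1`. [cite: ParkPham2024, Thm. 1.4] -/
theorem Inv.exists_subset_of_l_eq_zero_of_notSmall {F : Finset (Finset α)} {r L : ℝ} {l₀ : ℕ}
    {s : RoundState α} {V : Finset α} (h : Inv F r L l₀ s V) (hl : s.l = 0)
    (hns : ∀ G : Finset (Finset α), (∀ S ∈ F, ∃ T ∈ G, T ⊆ S) → 1 ≤ cost r G)
    (hΘ : Theta L l₀ < 1) : ∃ S ∈ F, S ⊆ V := by
  by_contra hne
  push Not at hne
  have hcover : ∀ S₀ ∈ F, ∃ T ∈ s.U, T ⊆ S₀ := by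
    intro S₀ hS₀
    rcases h.cov S₀ hS₀ with ⟨S₁, hS₁, hS₁V⟩ | hT | ⟨S, hS, hSS⟩
    · exact absurd hS₁V (hne S₁ hS₁)
    · exact hT
    · have hS0 : S = ∅ := card_eq_zero.1 (Nat.le_zero.1 (hl ▸ h.bdd S hS))
      obtain ⟨S₁, hS₁, hS₁sub⟩ := h.anc S hS
      rw [hS0, empty_union] at hS₁sub
      exact absurd hS₁sub (hne S₁ hS₁)
  have h1 : 1 ≤ cost r s.U := hns s.U hcover
  have h2 := h.cst
  rw [hl, Theta_zero, add_zero] at h2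
  linarith

/-- **From the process to the random set, not-small form** (Bell 2023, proof of Thm. 3;
Park–Pham 2024, Props. 2.3–2.4): for a state satisfying the invariant with used set `V`,
`Pr_{U ∼ μ_{p_I}}[no S ∈ F inside V ∪ U] ≤ failVal_I(s)`, assuming every undercover of `F`
costs `≥ 1`. Induction on `I`, splitting `μ_{p_{I+1}} = μ_{q'} ∗ μ_{p_I}`.
[cite: ParkPham2024, Thm. 1.4] -/
theorem sum_biasedWeight_noWitness_le_failVal_of_notSmall {F : Finset (Finset α)} {r L q' : ℝ}
    {l₀ : ℕ} (hns : ∀ G : Finset (Finset α), (∀ S ∈ F, ∃ T ∈ G, T ⊆ S) → 1 ≤ cost r G)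
    (hΘ : Theta L l₀ < 1) (hr : 0 ≤ r) (hL : 0 < L) (hq0 : 0 ≤ q') (hq1 : q' ≤ 1) :
    ∀ (I : ℕ) (s : RoundState α) (V : Finset α), Inv F r L l₀ s V →
      ∑ U : Finset α, biasedWeight (iterBias q' I) U * (if ∃ S ∈ F, S ⊆ V ∪ U then 0 else 1)
        ≤ failVal q' r L I s := by
  intro I
  induction I with
  | zero =>
    intro s V hinv
    simp only [iterBias, biasedWeight_zero, boole_mul]
    rw [sum_ite_eq' univ (∅ : Finset α)]
    simp only [mem_univ, if_true, union_empty]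
    unfold failVal
    by_cases hl : 1 ≤ s.l
    · rw [if_pos hl]; split_ifs <;> norm_num
    · rw [if_neg hl]
      have hl0 : s.l = 0 := by omega
      obtain ⟨S, hS, hSV⟩ := hinv.exists_subset_of_l_eq_zero_of_notSmall hl0 hns hΘ
      rw [if_pos ⟨S, hS, hSV⟩]
  | succ I ih =>
    intro s V hinv
    have hconv := sum_sum_biasedWeight_union (α := α) q' (iterBias q' I)
      fun U => if ∃ S ∈ F, S ⊆ V ∪ U then (0 : ℝ) else 1
    change ∑ U : Finset α, biasedWeight (q' + iterBias q' I - q' * iterBias q' I) U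
        * (if ∃ S ∈ F, S ⊆ V ∪ U then (0 : ℝ) else 1) ≤ _
    rw [← hconv]
    calc ∑ W : Finset α, ∑ U : Finset α, biasedWeight q' W * biasedWeight (iterBias q' I) U
          * (if ∃ S ∈ F, S ⊆ V ∪ (W ∪ U) then (0 : ℝ) else 1)
        = ∑ W : Finset α, biasedWeight q' W * ∑ U : Finset α, biasedWeight (iterBias q' I) U
          * (if ∃ S ∈ F, S ⊆ (V ∪ W) ∪ U then (0 : ℝ) else 1) := by
          refine sum_congr rfl fun W _ => ?_
          rw [mul_sum]
          refine sum_congr rfl fun U _ => ?_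
          rw [mul_assoc, union_assoc]
      _ ≤ ∑ W : Finset α, biasedWeight q' W * failVal q' r L I (step r L s W) :=
          sum_le_sum fun W _ => mul_le_mul_of_nonneg_left
            (ih (step r L s W) (V ∪ W) (hinv.step hr hL W)) (biasedWeight_nonneg hq0 hq1 W)
      _ = failVal q' r L (I + 1) s := rfl

/-- **The Park–Pham theorem, `p`-biased form with explicit constant** (Park–Pham 2024, Thm. 1.1 /
Thm. 1.4; Bell 2023, Thm. 3): for `ℓ ≥ 1`, `p, ε ∈ (0, 1/2]` and an `ℓ`-bounded family `F` in a
finite ground set which is NOT `q`-small for `q = p / (B log(ℓ/ε))`, `B = spreadConst` — i.e.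
every family `G` such that each member of `F` contains a member of `G` has
`∑_{T ∈ G} q^{|T|} ≥ 1` — a `p`-random subset `W` contains a member of `F` with probability
`> 1 - ε`: `Pr_{W ∼ μ_p}[∃ S ∈ F, S ⊆ W] > 1 - ε`. (`F` is automatically nonempty: the empty
family undercovers `∅` at cost `0`.) [cite: ParkPham2024, Thm. 1.1] -/
theorem parkPham_spreadConst {α : Type*} [Fintype α] [DecidableEq α]
    (F : Finset (Finset α)) (ℓ : ℕ) (p ε : ℝ) (hℓ : 1 ≤ ℓ) (hp0 : 0 < p) (hp1 : p ≤ 1 / 2)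
    (hε0 : 0 < ε) (hε1 : ε ≤ 1 / 2) (hbdd : ∀ S ∈ F, #S ≤ ℓ)
    (hns : ∀ G : Finset (Finset α), (∀ S ∈ F, ∃ T ∈ G, T ⊆ S) →
      1 ≤ ∑ T ∈ G, (p / (spreadConst * Real.log (ℓ / ε))) ^ #T) :
    1 - ε < ∑ W ∈ univ.filter (fun W : Finset α => ∃ S ∈ F, S ⊆ W), biasedWeight p W := by
  simp only [spreadConst] at hns
  -- parameters
  obtain ⟨hJ1, hJ2, hLg⟩ := rounds_bound hℓ hε0 hε1
  set Lg : ℝ := Real.log (ℓ / ε) with hLgdef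
  set J : ℕ := ⌈Real.logb 2 (4 * ℓ / ε)⌉₊ with hJdef
  set r : ℝ := 2000 * Lg / p with hrdef
  set L : ℝ := 64 with hLdef
  set q' : ℝ := L / r with hq'def
  set I : ℕ := 3 * J with hIdef
  have hLg0 : 0 < Lg := by linarith
  have hr0 : 0 < r := by positivity
  have hrp : r * p = 2000 * Lg := by rw [hrdef]; field_simp
  have hr64 : 64 ≤ r := by
    refine le_of_mul_le_mul_right ?_ hp0
    rw [hrp]; nlinarith
  have hq0 : 0 < q' := by positivity
  have hq1 : q' ≤ 1 := by rw [hq'def, div_le_one hr0]; exact hr64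
  have hrq : r * q' = L := by rw [hq'def]; field_simp
  have hΘ : Theta L ℓ < 1 := (Theta_le (by norm_num : (4 : ℝ) < 64) ℓ).trans_lt (by norm_num)
  -- the not-small hypothesis at rate `1/r = p / (2000 Lg)`
  have hinv_r : 1 / r = p / (2000 * Lg) := by
    rw [hrdef, one_div, inv_div]
  have hns' : ∀ G : Finset (Finset α), (∀ S ∈ F, ∃ T ∈ G, T ⊆ S) → 1 ≤ cost r G := by
    intro G hG
    have := hns G hG
    unfold cost
    simpa only [hinv_r] using this
  -- the bias of the union of the rounds is at most `p`
  obtain ⟨hpI0, hpIle⟩ := iterBias_nonneg_and_le hq0.le hq1 I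
  have hpIp : iterBias q' I ≤ p := by
    refine hpIle.trans ?_
    have hI : (I : ℝ) ≤ 30 * Lg := by
      rw [hIdef, Nat.cast_mul]; push_cast; linarith
    rw [hq'def, hLdef]
    rw [show (I : ℝ) * (64 / r) = (64 * I) / r by ring, div_le_iff₀ hr0, mul_comm p r, hrp]
    nlinarith
  -- the failure probability
  have hfail : failVal q' r L I ⟨F, ∅, ℓ⟩ < ε := by
    have h1 := failVal_le hr0 (by norm_num : (0 : ℝ) < 64) hq0 hq1 hrq I ⟨F, ∅, ℓ⟩ hbdd
    have h2 := two_pow_halvings_le hℓ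
    have h3 : (3 / 4 : ℝ) ^ I ≤ (1 / 2 : ℝ) ^ J := by
      rw [hIdef, pow_mul]
      exact pow_le_pow_left₀ (by norm_num) (by norm_num) J
    have hℓ0 : (0 : ℝ) < ℓ := by exact_mod_cast hℓ
    calc failVal q' r L I ⟨F, ∅, ℓ⟩ ≤ 2 ^ halvings ℓ * (3 / 4 : ℝ) ^ I := h1
      _ ≤ (2 * ℓ) * (ε / (4 * ℓ)) :=
          mul_le_mul h2 (h3.trans hJ1) (by positivity) (by positivity)
      _ = ε / 2 := by field_simp; ring
      _ < ε := by linarith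
  -- the chain of comparisons
  have hmono := sum_biasedWeight_mono_of_monotone hpI0 hpIp (by linarith)
    (fun W : Finset α => ∃ S ∈ F, S ⊆ W)
    (fun W U ⟨S, hS, hSW⟩ hWU => ⟨S, hS, hSW.trans hWU⟩)
  have hlink := sum_biasedWeight_noWitness_le_failVal_of_notSmall hns' hΘ hr0.le
    (by norm_num : (0 : ℝ) < 64) hq0.le hq1 I ⟨F, ∅, ℓ⟩ ∅ (Inv.init hbdd r L)
  simp only [empty_union] at hlink
  have hsplit : ∑ W ∈ univ.filter (fun W : Finset α => ∃ S ∈ F, S ⊆ W), biasedWeight (iterBias q' I) W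
      = 1 - ∑ U : Finset α, biasedWeight (iterBias q' I) U
          * (if ∃ S ∈ F, S ⊆ U then (0 : ℝ) else 1) := by
    have htot := sum_biasedWeight (α := α) (iterBias q' I)
    rw [← sum_filter_add_sum_filter_not univ (fun W : Finset α => ∃ S ∈ F, S ⊆ W)] at htot
    have hneg : ∑ U : Finset α, biasedWeight (iterBias q' I) U * (if ∃ S ∈ F, S ⊆ U then (0 : ℝ) else 1)
        = ∑ W ∈ univ.filter (fun W : Finset α => ¬ ∃ S ∈ F, S ⊆ W), biasedWeight (iterBias q' I) W := by
      rw [sum_filter]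
      refine sum_congr rfl fun U _ => ?_
      split_ifs <;> simp
    rw [hneg]
    linarith
  calc 1 - ε < 1 - failVal q' r L I ⟨F, ∅, ℓ⟩ := by linarith
    _ ≤ ∑ W ∈ univ.filter (fun W : Finset α => ∃ S ∈ F, S ⊆ W), biasedWeight (iterBias q' I) W := by
        rw [hsplit]; linarith
    _ ≤ ∑ W ∈ univ.filter (fun W : Finset α => ∃ S ∈ F, S ⊆ W), biasedWeight p W := hmono

/-- **The Park–Pham theorem (Kahn–Kalai conjecture), `p`-biased form**: there is an absolute
constant `B > 0` such that for every `ℓ ≥ 1`, `p, ε ∈ (0, 1/2]` and every `ℓ`-bounded family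
`F` that is not `(p / (B log(ℓ/ε)))`-small (every undercover `G` has `∑_{T ∈ G} q^{|T|} ≥ 1`),
`Pr_{W ∼ μ_p}[∃ S ∈ F, S ⊆ W] > 1 - ε`; i.e. `p_c(⟨F⟩) ≤ B · q(F) · log ℓ` in the language of
expectation thresholds (Park–Pham 2024, Thm. 1.1, resolving the Kahn–Kalai conjecture).
[cite: ParkPham2024, Thm. 1.1] -/
theorem parkPham : ∃ B : ℝ, 0 < B ∧ ∀ {α : Type*} [Fintype α] [DecidableEq α]
    (F : Finset (Finset α)) (ℓ : ℕ) (p ε : ℝ), 1 ≤ ℓ → 0 < p → p ≤ 1 / 2 → 0 < ε → ε ≤ 1 / 2 →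
    (∀ S ∈ F, #S ≤ ℓ) →
    (∀ G : Finset (Finset α), (∀ S ∈ F, ∃ T ∈ G, T ⊆ S) →
      1 ≤ ∑ T ∈ G, (p / (B * Real.log (ℓ / ε))) ^ #T) →
    1 - ε < ∑ W ∈ univ.filter (fun W : Finset α => ∃ S ∈ F, S ⊆ W), biasedWeight p W :=
  ⟨spreadConst, spreadConst_pos, fun F ℓ p ε => parkPham_spreadConst F ℓ p ε⟩

end Literature.Combinatorics.SetFamily
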